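import Summits.QuantumFields.YangMills.Theorems.UnitScaleTiltProp7CombFrameRem2Step
import Summits.QuantumFields.YangMills.Theorems.UnitScaleTiltProp7CombTreeRem2Letters
import HarnessLib

/-!
# Route `UnitScaleTilt`, crux K1 «MinimiserStabilityRegPr» (stmt-QuantumFields-19200), route-R E′ (A′)-on-Σ, P-A2 (β), R0 ∕ REM2ᶜ — file F-γᶜ2 «COMB FRAME REM2 RECURSION AT THE MEMBER»:
# **`Ψᶜ_{l+1} ≤ (L³)⁻¹·Ψᶜ_l + 477L²·Mᶜ_l + 3L·Dᶜ_l + 49·Φᶜ_l`** for every `l < K − n`, at a printed-regular background `W ∈ 𝔘_k(ε₀)` and a Hermitian traceless `X` of (19)-size `< ε₀∕6` —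
# the COMB twin of ✓px13 `Prop7FrameRem2RecursionT3.frameRem2_recursion_T3`, at ★routeR-w6 ✓`Prop7CombAccFrameMassOfRegPr.combFrameMass_recursion_of_regPr`'s member letters VERBATIM

Cell `ym3-torus` (HUMAN RULING D-0037: YM₃ on the torus is ladder rung R3 — not d = 4, not a mass gap, not Clay), width seat `ym3-torus-px17` (gen 4); ★★OWNER RULINGS №19 (3) ∕ №20 (1):
(R0) ⟸ Φᶜ + Φˢ + REM2ˢ + REM2ᶜ (✓px13 `Prop7R0OfFrameRows`), REM2ᶜ ⟸ `hMcomb₂` (admitted route-internal row, SIGNATURE-0′ 53b55878).  `--supports stmt-QuantumFields-19200 --as helper`;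
THEOREMS ONLY (0 `def`, 0 `sorry`); count-neutral.  Nothing of `hMcomb`∕`hMcomb₂`, (β), `hPA2`, `hcoS`, E′, EX, the crux, d = 4 or the gap is claimed.

THE LETTERS (★routeR-w6 F3a∕F3b VERBATIM: `U₀♯ = pull (bgUnits W) basePt`, `B♯ = fun z κ ↦ I•X⟨transl basePt z, κ⟩`, `Lᵏb = ε₀∕6`; per-level unitarity and sups ✓`comb_level_rows_of_regPr`, numerals
✓`member_windows` at `10⁷L⁴ε₀ ≤ 1`).  `Ψᶜ_l := Σ_{x : Site (F.P K) l} ‖v_l(x̂) − 1 − ℓ l x̂‖` (comb accumulated frames `v_l = vcov … l` at second order against ABSTRACT linear parts `ℓ : ℕ → ℤ³ → M₂`),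
`Mᶜ_l := Σ_x Σ_κ ‖Ũ₁ˡ(x̂,κ) − 1‖²` (THE `hMcomb` OBJECT), `Dᶜ_l := Σ_x Σ_κ D l x κ` with the DISPLAYED row **`hD : ‖Ũ₁ˡ(x̂,κ) − 1 − ℓY l x̂ κ‖ ≤ D l x κ`** (ABSTRACT link linear parts
`ℓY : ℕ → ℤ³ → Fin 3 → M₂`; at `ℓY l x̂ κ := fderiv ℂ (A′ ↦ ↑Ũ₁ˡ[A′](x̂,κ)) 0 (iX)` this is EXACTLY `hMcomb₂`'s summand — «route-internal row (n3)-comb₂, NOT N06, NOT a print row; OPEN»),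
`Φᶜ_l := Σ_x ‖v_l(x̂) − 1‖²`; the two families are tied by the DISPLAYED RECURSION IDENTITY **`hℓ : ℓ (l+1) ẑ = (L³)⁻¹ Σ_r ((R_{0,L•ẑ} ℓY l)(Γ_r) + Ū₀ˡ(Γ_r)·ℓ l (L•ẑ + r)·Ū₀ˡ(Γ_r)⁻¹)`**
(lit `tsum`; satisfied by `ℓ := fderiv` through ★routeR-w2 ✓p702200 `Prop7CombFrameLinearResponseStep.fderiv_coe_vcov_succ_apply` once the tree-ratio derivative is read as the transported sum of
the link derivatives — F-γᶜ3).

WHAT IS PROVED (ns `…Theorems.Prop7CombFrameRem2RecursionT3`).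
* ★★★ `combFrameRem2_recursion_of_regPr` — the title, for every `l < K − n`: ✓px17 `combFrameRem2_step_le` (F-αᶜ) with `E :=` the level-`l` remainder itself and the tree-ratio remainder row
  `SR z r := 3L·Dbox_l(z) + 9L²·Bᶜ_l(z)` from ✓px17 `norm_tHol_treeWord_sub_one_sub_tsum_le_of_box` (F-βᶜ-1) at the BOX of `z` (`s² := Bᶜ_l(z)` the box mass of `Ũ₁ˡ − 1`, `δ := Dbox_l(z)` the box
  `ℓ¹` sum of `D l`; `|Γ_r| ≤ 3L`, `3L·√Bᶜ ≤ ½` by ✓`member_windows`), the bi-contractivity∕sup∕unitarity rows and `C_R = 6L`, `δ₂ = 32ε₀`, `ρ = 780L³ε₀` EXACTLY as in ✓`combFrameMass_recursion_of_regPr`;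
  constants `477L² = 9L² + 13·(6L)²`, `3L`, `49`.
HONEST SCOPE.  Bookkeeping over F-αᶜ∕F-βᶜ-1∕F3a; `hD` (⟸ `hMcomb₂`) and `hℓ` DISPLAYED; the top mass in the E2E currency (Ψᶜ-induction ✓p702558 + profiles) is F-γᶜ3; nothing of print asserted.

References: T. Bałaban, CMP **98** (1985) 17–51 [Balaban1985Averaging] ((58) p.27, (82) p.30, (85)–(92) p.31, (97) p.32, Prop. 3 (122)–(123) p.36, (159)–(163) p.42); CMP **99** (1985) 75–102
[Balaban1985RegularSpaces] (Prop. 7 (1.139)–(1.145) p.100); CMP **102** (1985) 277–309 [Balaban1985Variational] ((19) p.281, (44) p.285); CMP **109** (1987) 249–301 [Balaban1987RG1] ((0.3)–(0.4) pp.252–253).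
-/

set_option autoImplicit false

noncomputable section

open scoped BigOperators Matrix.Norms.L2Operator

namespace Summit.QuantumFields.YangMills.Theorems.Prop7CombFrameRem2RecursionT3

open Finset NormedSpace
open Literature.MathematicalPhysics.QuantumFieldTheory.Balaban1983to89
open Literature.MathematicalPhysics.QuantumFieldTheory.Balaban1983to89.T3ContinuumYM3Torus
open T4Continuum BlockAveraging
open T3PrintedRegularMinimiser (RegPr)
open T3SectALandauChart (eta eta_pos bgUnits)
open B7Prop1Explicit renaming Site → LSite
open B7Prop1Explicit (e hol disp treeWord disp_treeWord boxVec expUnit U1 mem_U1 l1 length_treeWord l1_boxVec_le)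
open B7Prop1Local (InBox)
open B7Prop2Explicit (avgIter pdev C0 c2' unitaryUnits unitaryUnits_le_U1 hol_mem_of)
open B7Prop3Flat (expCfg)
open B7Eq92Concrete (Rc Rc_apply tHol tildIter dbavgCovIter vcov vcov_zero)
open B7Prop3GeneralRotated renaming tsum → covTsum
open B10Eq27TorusAxialLog (pull pull_apply transl)
open Summit.QuantumFields.YangMills.Theorems.Prop7SPrint (basePt)
open Summit.QuantumFields.YangMills.Theorems.Prop7TPrint (nMax19)
open Summit.QuantumFields.YangMills.Theorems.LinearLiftGauge (sum_blockSite_eq)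
open Summit.QuantumFields.YangMills.Theorems.Prop7BlockMeanContraction (sum_sum_block_eq)
open Summit.QuantumFields.YangMills.Theorems.Prop7CombAccFrameMassStep (valLift_blockSite sum_blockLift_eq le_sqrt_sum_sq)
open Summit.QuantumFields.YangMills.Theorems.Prop7CombTowerRowsOfRegPr (norm_tHol_treeWord_sub_one_le_of_box member_windows comb_level_rows_of_regPr)
open Summit.QuantumFields.YangMills.Theorems.Prop7CombFrameRem2Step (combFrameRem2_step_le)
open Summit.QuantumFields.YangMills.Theorems.Prop7CombTreeRem2Letters (norm_tHol_treeWord_sub_one_sub_tsum_le_of_box)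
open B11Eq98V0LettersFlat (norm_inv_sub_one_le)

section Member

variable (F : T3Family) {n K : ℕ} (h : n ≤ K)

set_option maxHeartbeats 400000 in
/-- ★★★ **THE COMB ACCUMULATED-FRAME RECURSION AT SECOND ORDER, AT A PRINTED-REGULAR BACKGROUND** (see the module docstring): for every `l < K − n`,
`Σ_z ‖v_{l+1}(ẑ) − 1 − ℓ (l+1) ẑ‖ ≤ (L³)⁻¹·Σ_x ‖v_l(x̂) − 1 − ℓ l x̂‖ + 477L²·Σ_xΣ_κ‖Ũ₁ˡ(x̂,κ) − 1‖² + 3L·Σ_xΣ_κ D l x κ + 49·Σ_x‖v_l(x̂) − 1‖²`, under the displayed rows `hD` (link second-order remainders,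
the `hMcomb₂` shape) and `hℓ` (the linear-part recursion). [cite: Balaban1985Averaging, (58) p.27, (82) p.30, (97) p.32, Prop. 3 (122)-(123) p.36, (159)-(163) p.42; Balaban1985RegularSpaces, Prop. 7 (1.139)-(1.145) p.100; Balaban1987RG1, (0.3)-(0.4) pp.252-253] -/
theorem combFrameRem2_recursion_of_regPr {ε₀ : ℝ} (hε₀ : 0 < ε₀) (hε : 10 ^ 7 * (F.L : ℝ) ^ 4 * ε₀ ≤ 1)
    (W : GaugeField (F.P K) 0 (Matrix.specialUnitaryGroup (Fin 2) ℂ)) (hreg : RegPr F n K ε₀ W)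
    (X : PBond (F.P K) 0 → Matrix (Fin 2) (Fin 2) ℂ) (hX : ∀ b, (X b).IsHermitian ∧ (X b).trace = 0) (hX6 : nMax19 F n K W X < ε₀ / 6)
    (ℓ : ℕ → LSite (F.P K).d → Matrix (Fin 2) (Fin 2) ℂ) (ℓY : ℕ → LSite (F.P K).d → Fin (F.P K).d → Matrix (Fin 2) (Fin 2) ℂ)
    (hℓ : ∀ l : ℕ, l < K - n → ∀ z : Site (F.P K) (l + 1),
      ℓ (l + 1) (fun μ => ((z μ).val : ℤ))
        = ((Fintype.card (Fin (F.P K).d → Fin (F.P K).L) : ℂ))⁻¹ • ∑ r : Fin (F.P K).d → Fin (F.P K).L,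
            (covTsum (avgIter (F.P K).L (pull (bgUnits F K W) (basePt F n K)) l) (ℓY l) (((F.P K).L : ℤ) • (fun μ => ((z μ).val : ℤ))) (treeWord (boxVec (F.P K).L r))
              + ((hol (avgIter (F.P K).L (pull (bgUnits F K W) (basePt F n K)) l) (((F.P K).L : ℤ) • (fun μ => ((z μ).val : ℤ))) (treeWord (boxVec (F.P K).L r)) :
                    (Matrix (Fin 2) (Fin 2) ℂ)ˣ) : Matrix (Fin 2) (Fin 2) ℂ)
                * ℓ l (((F.P K).L : ℤ) • (fun μ => ((z μ).val : ℤ)) + boxVec (F.P K).L r)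
                * (((hol (avgIter (F.P K).L (pull (bgUnits F K W) (basePt F n K)) l) (((F.P K).L : ℤ) • (fun μ => ((z μ).val : ℤ))) (treeWord (boxVec (F.P K).L r)))⁻¹ :
                    (Matrix (Fin 2) (Fin 2) ℂ)ˣ) : Matrix (Fin 2) (Fin 2) ℂ)))
    (D : ℕ → (l : ℕ) → Site (F.P K) l → Fin (F.P K).d → ℝ) (hD0 : ∀ l' l x κ, 0 ≤ D l' l x κ)
    (hD : ∀ l : ℕ, l < K - n → ∀ (x : Site (F.P K) l) (κ : Fin (F.P K).d),
      ‖((tildIter (F.P K).L (pull (bgUnits F K W) (basePt F n K)) (expCfg fun z κ => Complex.I • X ⟨transl (basePt F n K) z, κ⟩) l (fun μ => ((x μ).val : ℤ)) κ :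
            (Matrix (Fin 2) (Fin 2) ℂ)ˣ) : Matrix (Fin 2) (Fin 2) ℂ) - 1 - ℓY l (fun μ => ((x μ).val : ℤ)) κ‖ ≤ D l l x κ)
    {l : ℕ} (hl : l < K - n) :
    ∑ z : Site (F.P K) (l + 1), ‖((vcov (F.P K).L (pull (bgUnits F K W) (basePt F n K)) (expCfg fun z κ => Complex.I • X ⟨transl (basePt F n K) z, κ⟩) (l + 1)
          (fun μ => ((z μ).val : ℤ)) : (Matrix (Fin 2) (Fin 2) ℂ)ˣ) : Matrix (Fin 2) (Fin 2) ℂ) - 1 - ℓ (l + 1) (fun μ => ((z μ).val : ℤ))‖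
      ≤ ((F.L : ℝ) ^ 3)⁻¹
          * ∑ x : Site (F.P K) l, ‖((vcov (F.P K).L (pull (bgUnits F K W) (basePt F n K)) (expCfg fun z κ => Complex.I • X ⟨transl (basePt F n K) z, κ⟩) l
              (fun μ => ((x μ).val : ℤ)) : (Matrix (Fin 2) (Fin 2) ℂ)ˣ) : Matrix (Fin 2) (Fin 2) ℂ) - 1 - ℓ l (fun μ => ((x μ).val : ℤ))‖
        + 477 * (F.L : ℝ) ^ 2
          * ∑ x : Site (F.P K) l, ∑ κ : Fin (F.P K).d, ‖((tildIter (F.P K).L (pull (bgUnits F K W) (basePt F n K)) (expCfg fun z κ => Complex.I • X ⟨transl (basePt F n K) z, κ⟩) l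
              (fun μ => ((x μ).val : ℤ)) κ : (Matrix (Fin 2) (Fin 2) ℂ)ˣ) : Matrix (Fin 2) (Fin 2) ℂ) - 1‖ ^ 2
        + 3 * (F.L : ℝ) * ∑ x : Site (F.P K) l, ∑ κ : Fin (F.P K).d, D l l x κ
        + 49 * ∑ x : Site (F.P K) l, ‖((vcov (F.P K).L (pull (bgUnits F K W) (basePt F n K)) (expCfg fun z κ => Complex.I • X ⟨transl (basePt F n K) z, κ⟩) l
              (fun μ => ((x μ).val : ℤ)) : (Matrix (Fin 2) (Fin 2) ℂ)ˣ) : Matrix (Fin 2) (Fin 2) ℂ) - 1‖ ^ 2 := by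
  letI : CStarAlgebra (Matrix (Fin 2) (Fin 2) ℂ) := B10Eq29TubeLine.cstarAlgebraMatrix 2
  have hL3 : (3 : ℝ) ≤ F.L := by
    have h3 : 3 ≤ F.L := by obtain ⟨a, ha⟩ := F.hL.1; have := F.hL.2; omega
    exact_mod_cast h3
  have hL0 : (0 : ℝ) < F.L := by linarith
  have hε3 : 10 ^ 7 * (F.L : ℝ) ^ 3 * ε₀ ≤ 1 := by
    have h34 : (F.L : ℝ) ^ 3 ≤ (F.L : ℝ) ^ 4 := pow_le_pow_right₀ (by linarith) (by norm_num)
    nlinarith [h34, hε₀.le]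
  have hd3 : (F.P K).d = 3 := T3Family.P_d F K
  have hPL : (((F.P K).L : ℕ) : ℝ) = (F.L : ℝ) := rfl
  have hLd : (((F.P K).L : ℝ) ^ (F.P K).d) = (F.L : ℝ) ^ 3 := by rw [hd3]; rfl
  have hcardR : (Fintype.card (Fin (F.P K).d → Fin (F.P K).L) : ℝ) = (F.L : ℝ) ^ 3 := by
    rw [Fintype.card_fun, Fintype.card_fin, Fintype.card_fin, hd3]; push_cast; rw [hPL]
  have hlm : l + 1 ≤ (F.P K).m + (F.P K).K := by
    show l + 1 ≤ F.m + K
    have := F.hm; omega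
  obtain ⟨hw1, hw2, hw3, -, -⟩ := member_windows F hε₀.le hε
  -- F3a's rows at level `l`
  obtain ⟨hA, -, hVu, hV2, hT, hTu⟩ := comb_level_rows_of_regPr F hε₀ hε3 W hreg X hX hX6 l hl.le
  -- letters
  set U₀' := pull (bgUnits F K W) (basePt F n K) with hU₀'
  set B' : LSite (F.P K).d → Fin (F.P K).d → Matrix (Fin 2) (Fin 2) ℂ := fun z κ => Complex.I • X ⟨transl (basePt F n K) z, κ⟩ with hB'
  -- the box mass of `Ũ₁ˡ − 1` and the box `ℓ¹` sum of `D l`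
  set Bl : Site (F.P K) (l + 1) → ℝ := fun z => ∑ r' : Fin (F.P K).d → Fin (F.P K).L, ∑ κ : Fin (F.P K).d,
    ‖((tildIter (F.P K).L U₀' (expCfg B') l (((F.P K).L : ℤ) • (fun μ => ((z μ).val : ℤ)) + boxVec (F.P K).L r') κ : (Matrix (Fin 2) (Fin 2) ℂ)ˣ) : Matrix (Fin 2) (Fin 2) ℂ) - 1‖ ^ 2
    with hBl
  set Dbox : Site (F.P K) (l + 1) → ℝ := fun z => ∑ r' : Fin (F.P K).d → Fin (F.P K).L, ∑ κ : Fin (F.P K).d, D l l (Site.blockSite z r') κ with hDbox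
  have hBl0 : ∀ z, 0 ≤ Bl z := fun z => Finset.sum_nonneg fun _ _ => Finset.sum_nonneg fun _ _ => sq_nonneg _
  have hDbox0 : ∀ z, 0 ≤ Dbox z := fun z => Finset.sum_nonneg fun _ _ => Finset.sum_nonneg fun _ _ => hD0 _ _ _ _
  -- `√Bl ≤ 2L²·65ε₀`
  have hsqrtBl : ∀ z, Real.sqrt (Bl z) ≤ 2 * (F.L : ℝ) ^ 2 * (65 * ε₀) := by
    intro z
    have hterm : Bl z ≤ ∑ _r' : Fin (F.P K).d → Fin (F.P K).L, ∑ _κ : Fin (F.P K).d, (65 * ε₀) ^ 2 := by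
      refine Finset.sum_le_sum fun r' _ => Finset.sum_le_sum fun κ _ => ?_
      exact pow_le_pow_left₀ (norm_nonneg _) (hT _ _) 2
    have hcount : (∑ _r' : Fin (F.P K).d → Fin (F.P K).L, ∑ _κ : Fin (F.P K).d, (65 * ε₀) ^ 2 : ℝ) = 3 * (F.L : ℝ) ^ 3 * (65 * ε₀) ^ 2 := by
      simp only [Finset.sum_const, Finset.card_univ, Fintype.card_fun, Fintype.card_fin, nsmul_eq_mul, hd3]
      push_cast
      rw [hPL]
      ring
    rw [hcount] at hterm
    calc Real.sqrt (Bl z) ≤ Real.sqrt (3 * (F.L : ℝ) ^ 3 * (65 * ε₀) ^ 2) := Real.sqrt_le_sqrt hterm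
      _ = Real.sqrt (3 * (F.L : ℝ) ^ 3) * (65 * ε₀) := by
          rw [Real.sqrt_mul (by positivity), Real.sqrt_sq (by positivity)]
      _ ≤ 2 * (F.L : ℝ) ^ 2 * (65 * ε₀) := mul_le_mul_of_nonneg_right hw3 (by positivity)
  -- the U1 readings
  have hU1hol : ∀ (z : Site (F.P K) (l + 1)) (r : Fin (F.P K).d → Fin (F.P K).L),
      ‖((hol (avgIter (F.P K).L U₀' l) (((F.P K).L : ℤ) • (fun μ => ((z μ).val : ℤ))) (treeWord (boxVec (F.P K).L r)) : (Matrix (Fin 2) (Fin 2) ℂ)ˣ) : Matrix (Fin 2) (Fin 2) ℂ)‖ ≤ 1 ∧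
        ‖(((hol (avgIter (F.P K).L U₀' l) (((F.P K).L : ℤ) • (fun μ => ((z μ).val : ℤ))) (treeWord (boxVec (F.P K).L r)))⁻¹ : (Matrix (Fin 2) (Fin 2) ℂ)ˣ) : Matrix (Fin 2) (Fin 2) ℂ)‖ ≤ 1 :=
    fun z r => mem_U1.1 (unitaryUnits_le_U1 (hol_mem_of hA _ _))
  have hv1 : ∀ x : Site (F.P K) l, ‖((vcov (F.P K).L U₀' (expCfg B') l (fun μ => ((x μ).val : ℤ)) : (Matrix (Fin 2) (Fin 2) ℂ)ˣ) : Matrix (Fin 2) (Fin 2) ℂ)‖ ≤ 1 :=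
    fun x => (mem_U1.1 (unitaryUnits_le_U1 (hVu _))).1
  have hv1' : ∀ x : Site (F.P K) l, ‖(((vcov (F.P K).L U₀' (expCfg B') l (fun μ => ((x μ).val : ℤ)))⁻¹ : (Matrix (Fin 2) (Fin 2) ℂ)ˣ) : Matrix (Fin 2) (Fin 2) ℂ)‖ ≤ 1 :=
    fun x => (mem_U1.1 (unitaryUnits_le_U1 (hVu _))).2
  have hv2 : ∀ x : Site (F.P K) l, ‖((vcov (F.P K).L U₀' (expCfg B') l (fun μ => ((x μ).val : ℤ)) : (Matrix (Fin 2) (Fin 2) ℂ)ˣ) : Matrix (Fin 2) (Fin 2) ℂ) - 1‖ ≤ 32 * ε₀ :=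
    fun x => (hV2 _).1
  have hV₀bi : ∀ x κ, ‖((avgIter (F.P K).L U₀' l x κ : (Matrix (Fin 2) (Fin 2) ℂ)ˣ) : Matrix (Fin 2) (Fin 2) ℂ)‖ ≤ 1 ∧
      ‖(((avgIter (F.P K).L U₀' l x κ)⁻¹ : (Matrix (Fin 2) (Fin 2) ℂ)ˣ) : Matrix (Fin 2) (Fin 2) ℂ)‖ ≤ 1 := fun x κ => mem_U1.1 (unitaryUnits_le_U1 (hA x κ))
  have hV₀U1 : ∀ x κ, avgIter (F.P K).L U₀' l x κ ∈ U1 (Matrix (Fin 2) (Fin 2) ℂ) := fun x κ => unitaryUnits_le_U1 (hA x κ)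
  -- the BOX of a coarse site and its two rows: the tree-ratio row `hR` (first order) and the tree remainder row `hSR` (second order)
  have hbox_rows : ∀ (z : Site (F.P K) (l + 1)) (r : Fin (F.P K).d → Fin (F.P K).L),
      ‖((tHol (avgIter (F.P K).L U₀' l) (tildIter (F.P K).L U₀' (expCfg B') l) (((F.P K).L : ℤ) • (fun μ => ((z μ).val : ℤ))) (treeWord (boxVec (F.P K).L r)) :
          (Matrix (Fin 2) (Fin 2) ℂ)ˣ) : Matrix (Fin 2) (Fin 2) ℂ) - 1‖ ≤ 6 * (F.L : ℝ) * Real.sqrt (Bl z) ∧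
      ‖((tHol (avgIter (F.P K).L U₀' l) (tildIter (F.P K).L U₀' (expCfg B') l) (((F.P K).L : ℤ) • (fun μ => ((z μ).val : ℤ))) (treeWord (boxVec (F.P K).L r)) :
          (Matrix (Fin 2) (Fin 2) ℂ)ˣ) : Matrix (Fin 2) (Fin 2) ℂ) - 1
          - covTsum (avgIter (F.P K).L U₀' l) (ℓY l) (((F.P K).L : ℤ) • (fun μ => ((z μ).val : ℤ))) (treeWord (boxVec (F.P K).L r))‖
        ≤ 3 * (F.L : ℝ) * Dbox z + 9 * (F.L : ℝ) ^ 2 * Bl z := by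
    intro z r
    set zh : LSite (F.P K).d := fun μ => ((z μ).val : ℤ) with hzh
    set lo : LSite (F.P K).d := ((F.P K).L : ℤ) • zh with hlo
    set hi : LSite (F.P K).d := ((F.P K).L : ℤ) • zh + fun _ => (((F.P K).L : ℤ) - 1) with hhi
    have hLpos : 0 < (F.P K).L := (F.P K).L_pos
    -- sites of the box are box points `L•ẑ + boxVec r'`
    have hbox : ∀ x : LSite (F.P K).d, InBox lo hi x → ∃ r' : Fin (F.P K).d → Fin (F.P K).L, x = ((F.P K).L : ℤ) • zh + boxVec (F.P K).L r' := by
      intro x hx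
      refine ⟨fun μ => ⟨(x μ - ((F.P K).L : ℤ) * zh μ).toNat, ?_⟩, ?_⟩
      · have h1 := (hx μ).1; have h2 := (hx μ).2
        simp only [hlo, hhi, Pi.smul_apply, Pi.add_apply, smul_eq_mul] at h1 h2
        omega
      · funext μ
        have h1 := (hx μ).1; have h2 := (hx μ).2
        simp only [hlo, hhi, Pi.smul_apply, Pi.add_apply, smul_eq_mul] at h1 h2
        simp only [Pi.add_apply, Pi.smul_apply, smul_eq_mul, boxVec]
        rw [Int.toNat_of_nonneg (by omega)]
        ring
    have hs0 : 0 ≤ Real.sqrt (Bl z) := Real.sqrt_nonneg _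
    -- every box bond: within `√Bl` of `1`, unitary, and its second-order remainder `≤ Dbox`
    have hle_of_box : ∀ x κ, InBox lo hi x →
        ‖((tildIter (F.P K).L U₀' (expCfg B') l x κ : (Matrix (Fin 2) (Fin 2) ℂ)ˣ) : Matrix (Fin 2) (Fin 2) ℂ) - 1‖ ≤ Real.sqrt (Bl z) ∧
          ‖((tildIter (F.P K).L U₀' (expCfg B') l x κ : (Matrix (Fin 2) (Fin 2) ℂ)ˣ) : Matrix (Fin 2) (Fin 2) ℂ) - 1 - ℓY l x κ‖ ≤ Dbox z := by
      intro x κ hx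
      obtain ⟨r', hr'⟩ := hbox x hx
      refine ⟨?_, ?_⟩
      · rw [← Real.sqrt_sq (norm_nonneg _)]
        refine Real.sqrt_le_sqrt ?_
        rw [hBl]; dsimp only
        refine le_trans ?_ (Finset.single_le_sum (f := fun r'' : Fin (F.P K).d → Fin (F.P K).L => ∑ κ' : Fin (F.P K).d,
          ‖((tildIter (F.P K).L U₀' (expCfg B') l (((F.P K).L : ℤ) • zh + boxVec (F.P K).L r'') κ' : (Matrix (Fin 2) (Fin 2) ℂ)ˣ) : Matrix (Fin 2) (Fin 2) ℂ) - 1‖ ^ 2)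
          (fun _ _ => Finset.sum_nonneg fun _ _ => sq_nonneg _) (Finset.mem_univ r'))
        rw [hr']
        exact Finset.single_le_sum (f := fun κ' : Fin (F.P K).d =>
          ‖((tildIter (F.P K).L U₀' (expCfg B') l (((F.P K).L : ℤ) • zh + boxVec (F.P K).L r') κ' : (Matrix (Fin 2) (Fin 2) ℂ)ˣ) : Matrix (Fin 2) (Fin 2) ℂ) - 1‖ ^ 2)
          (fun _ _ => sq_nonneg _) (Finset.mem_univ κ)
      · have hx' : x = fun μ => (((Site.blockSite z r') μ).val : ℤ) := by rw [hr', hzh]; exact (valLift_blockSite (P := F.P K) hlm z r').symm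
        rw [hx']
        refine (hD l hl (Site.blockSite z r') κ).trans ?_
        rw [hDbox]; dsimp only
        refine le_trans ?_ (Finset.single_le_sum (f := fun r'' : Fin (F.P K).d → Fin (F.P K).L => ∑ κ' : Fin (F.P K).d, D l l (Site.blockSite z r'') κ')
          (fun _ _ => Finset.sum_nonneg fun _ _ => hD0 _ _ _ _) (Finset.mem_univ r'))
        exact Finset.single_le_sum (f := fun κ' : Fin (F.P K).d => D l l (Site.blockSite z r') κ') (fun _ _ => hD0 _ _ _ _) (Finset.mem_univ κ)
    have hV₁ : ∀ x κ, InBox lo hi x → InBox lo hi (x + e κ) →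
        ‖((tildIter (F.P K).L U₀' (expCfg B') l x κ : (Matrix (Fin 2) (Fin 2) ℂ)ˣ) : Matrix (Fin 2) (Fin 2) ℂ) - 1‖ ≤ Real.sqrt (Bl z) ∧
          ‖(((tildIter (F.P K).L U₀' (expCfg B') l x κ)⁻¹ : (Matrix (Fin 2) (Fin 2) ℂ)ˣ) : Matrix (Fin 2) (Fin 2) ℂ) - 1‖ ≤ Real.sqrt (Bl z) := by
      intro x κ hx _
      have hle := (hle_of_box x κ hx).1
      exact ⟨hle, (norm_inv_sub_one_le _ (mem_U1.1 (unitaryUnits_le_U1 (hTu x κ))).2).trans hle⟩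
    have hV₁' : ∀ x κ, InBox lo hi x → InBox lo hi (x + e κ) →
        tildIter (F.P K).L U₀' (expCfg B') l x κ ∈ U1 (Matrix (Fin 2) (Fin 2) ℂ) ∧
          ‖((tildIter (F.P K).L U₀' (expCfg B') l x κ : (Matrix (Fin 2) (Fin 2) ℂ)ˣ) : Matrix (Fin 2) (Fin 2) ℂ) - 1‖ ≤ Real.sqrt (Bl z) :=
      fun x κ hx _ => ⟨unitaryUnits_le_U1 (hTu x κ), (hle_of_box x κ hx).1⟩
    have hℓY : ∀ x κ, InBox lo hi x → InBox lo hi (x + e κ) →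
        ‖((tildIter (F.P K).L U₀' (expCfg B') l x κ : (Matrix (Fin 2) (Fin 2) ℂ)ˣ) : Matrix (Fin 2) (Fin 2) ℂ) - 1 - ℓY l x κ‖ ≤ Dbox z :=
      fun x κ hx _ => (hle_of_box x κ hx).2
    have hp : InBox lo hi lo := fun μ => ⟨le_rfl, by
      simp only [hhi, hlo, Pi.add_apply, Pi.smul_apply, smul_eq_mul, le_add_iff_nonneg_right]; have := hLpos; omega⟩
    have hv0 : ∀ κ, (0 : ℤ) ≤ boxVec (F.P K).L r κ := fun κ => by simp [boxVec]
    have hpv : InBox lo hi (lo + boxVec (F.P K).L r) := fun μ => by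
      have h0 : (0 : ℤ) ≤ boxVec (F.P K).L r μ := hv0 μ
      have h1 : boxVec (F.P K).L r μ ≤ ((F.P K).L : ℤ) - 1 := by
        simp only [boxVec]; have := (r μ).isLt; omega
      simp only [hhi, hlo, Pi.add_apply, Pi.smul_apply, smul_eq_mul]
      exact ⟨by linarith, by linarith⟩
    -- length and smallness
    have hlen : ((treeWord (boxVec (F.P K).L r)).length : ℝ) ≤ 3 * (F.L : ℝ) := by
      rw [length_treeWord]
      have h' : ((l1 (boxVec (F.P K).L r) : ℕ) : ℝ) ≤ (((F.P K).d : ℕ) : ℝ) * (((F.P K).L : ℕ) : ℝ) := by exact_mod_cast l1_boxVec_le (F.P K).L r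
      have hd3r : (((F.P K).d : ℕ) : ℝ) = 3 := by exact_mod_cast hd3
      rw [hd3r, hPL] at h'
      exact h'
    have hlen0 : (0 : ℝ) ≤ ((treeWord (boxVec (F.P K).L r)).length : ℝ) := Nat.cast_nonneg _
    have hn : ((treeWord (boxVec (F.P K).L r)).length : ℝ) * Real.sqrt (Bl z) ≤ 1 / 2 :=
      le_trans (mul_le_mul hlen (hsqrtBl z) hs0 (by positivity)) hw2
    refine ⟨?_, ?_⟩
    · have h := norm_tHol_treeWord_sub_one_le_of_box (avgIter (F.P K).L U₀' l) (tildIter (F.P K).L U₀' (expCfg B') l) hV₀bi hs0 hV₁ lo (boxVec (F.P K).L r) hp hpv hn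
      refine h.trans ?_
      nlinarith [mul_le_mul_of_nonneg_right hlen hs0]
    · have h := norm_tHol_treeWord_sub_one_sub_tsum_le_of_box (avgIter (F.P K).L U₀' l) (tildIter (F.P K).L U₀' (expCfg B') l) hV₀U1 hs0 (hDbox0 z)
        hV₁' (ℓY l) hℓY lo (boxVec (F.P K).L r) hv0 hp hpv (hn.trans (by norm_num))
      refine h.trans ?_
      have h1 : ((treeWord (boxVec (F.P K).L r)).length : ℝ) * Dbox z ≤ 3 * (F.L : ℝ) * Dbox z := mul_le_mul_of_nonneg_right hlen (hDbox0 z)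
      have h2 : (((treeWord (boxVec (F.P K).L r)).length : ℝ) * Real.sqrt (Bl z)) ^ 2 ≤ (3 * (F.L : ℝ) * Real.sqrt (Bl z)) ^ 2 :=
        pow_le_pow_left₀ (by positivity) (mul_le_mul_of_nonneg_right hlen hs0) 2
      have e2 : (3 * (F.L : ℝ) * Real.sqrt (Bl z)) ^ 2 = 9 * (F.L : ℝ) ^ 2 * Bl z := by rw [mul_pow, Real.sq_sqrt (hBl0 z)]; ring
      linarith
  have hR : ∀ (z : Site (F.P K) (l + 1)) (r : Fin (F.P K).d → Fin (F.P K).L),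
      ‖((tHol (avgIter (F.P K).L U₀' l) (tildIter (F.P K).L U₀' (expCfg B') l) (((F.P K).L : ℤ) • (fun μ => ((z μ).val : ℤ))) (treeWord (boxVec (F.P K).L r)) :
          (Matrix (Fin 2) (Fin 2) ℂ)ˣ) : Matrix (Fin 2) (Fin 2) ℂ) - 1‖ ≤ 6 * (F.L : ℝ) * Real.sqrt (Bl z) := fun z r => (hbox_rows z r).1
  have hρB : ∀ z, 6 * (F.L : ℝ) * Real.sqrt (Bl z) ≤ 780 * (F.L : ℝ) ^ 3 * ε₀ := by
    intro z
    calc 6 * (F.L : ℝ) * Real.sqrt (Bl z) ≤ 6 * (F.L : ℝ) * (2 * (F.L : ℝ) ^ 2 * (65 * ε₀)) := mul_le_mul_of_nonneg_left (hsqrtBl z) (by positivity)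
      _ = 780 * (F.L : ℝ) ^ 3 * ε₀ := by ring
  have ht : 780 * (F.L : ℝ) ^ 3 * ε₀ + 3 * (32 * ε₀) ≤ 1 / 4 := hw1.trans (by norm_num)
  -- F-αᶜ with `E :=` the remainder itself and `SR := 3L·Dbox + 9L²·Bl`
  have hstep := combFrameRem2_step_le (P := F.P K) (𝔸 := Matrix (Fin 2) (Fin 2) ℂ) hlm U₀' (expCfg B') Bl (by positivity : (0 : ℝ) ≤ 6 * (F.L : ℝ)) hBl0
    (by positivity : (0 : ℝ) ≤ 32 * ε₀) (by positivity : (0 : ℝ) ≤ 780 * (F.L : ℝ) ^ 3 * ε₀) hU1hol hv1 hv1' hv2 hR hρB ht (ℓ l)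
    (fun x => ‖((vcov (F.P K).L U₀' (expCfg B') l (fun μ => ((x μ).val : ℤ)) : (Matrix (Fin 2) (Fin 2) ℂ)ˣ) : Matrix (Fin 2) (Fin 2) ℂ) - 1 - ℓ l (fun μ => ((x μ).val : ℤ))‖)
    (fun x => le_rfl)
    (fun z r => covTsum (avgIter (F.P K).L U₀' l) (ℓY l) (((F.P K).L : ℤ) • (fun μ => ((z μ).val : ℤ))) (treeWord (boxVec (F.P K).L r)))
    (fun z _ => 3 * (F.L : ℝ) * Dbox z + 9 * (F.L : ℝ) ^ 2 * Bl z) (fun z r => (hbox_rows z r).2)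
  -- the linear part is `ℓ (l+1)` by the displayed recursion
  have hlin : ∀ z : Site (F.P K) (l + 1),
      ℓ (l + 1) (fun μ => ((z μ).val : ℤ))
        = ((Fintype.card (Fin (F.P K).d → Fin (F.P K).L) : ℂ))⁻¹ • ∑ r : Fin (F.P K).d → Fin (F.P K).L,
            (covTsum (avgIter (F.P K).L U₀' l) (ℓY l) (((F.P K).L : ℤ) • (fun μ => ((z μ).val : ℤ))) (treeWord (boxVec (F.P K).L r))
              + ((hol (avgIter (F.P K).L U₀' l) (((F.P K).L : ℤ) • (fun μ => ((z μ).val : ℤ))) (treeWord (boxVec (F.P K).L r)) : (Matrix (Fin 2) (Fin 2) ℂ)ˣ) : Matrix (Fin 2) (Fin 2) ℂ)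
                * ℓ l (((F.P K).L : ℤ) • (fun μ => ((z μ).val : ℤ)) + boxVec (F.P K).L r)
                * (((hol (avgIter (F.P K).L U₀' l) (((F.P K).L : ℤ) • (fun μ => ((z μ).val : ℤ))) (treeWord (boxVec (F.P K).L r)))⁻¹ : (Matrix (Fin 2) (Fin 2) ℂ)ˣ) : Matrix (Fin 2) (Fin 2) ℂ)) :=
    fun z => hℓ l hl z
  have hLHS : ∑ z : Site (F.P K) (l + 1), ‖((vcov (F.P K).L U₀' (expCfg B') (l + 1) (fun μ => ((z μ).val : ℤ)) : (Matrix (Fin 2) (Fin 2) ℂ)ˣ) : Matrix (Fin 2) (Fin 2) ℂ) - 1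
        - ℓ (l + 1) (fun μ => ((z μ).val : ℤ))‖
      = ∑ z : Site (F.P K) (l + 1), ‖((vcov (F.P K).L U₀' (expCfg B') (l + 1) (fun μ => ((z μ).val : ℤ)) : (Matrix (Fin 2) (Fin 2) ℂ)ˣ) : Matrix (Fin 2) (Fin 2) ℂ) - 1
        - ((Fintype.card (Fin (F.P K).d → Fin (F.P K).L) : ℂ))⁻¹ • ∑ r : Fin (F.P K).d → Fin (F.P K).L,
            (covTsum (avgIter (F.P K).L U₀' l) (ℓY l) (((F.P K).L : ℤ) • (fun μ => ((z μ).val : ℤ))) (treeWord (boxVec (F.P K).L r))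
              + ((hol (avgIter (F.P K).L U₀' l) (((F.P K).L : ℤ) • (fun μ => ((z μ).val : ℤ))) (treeWord (boxVec (F.P K).L r)) : (Matrix (Fin 2) (Fin 2) ℂ)ˣ) : Matrix (Fin 2) (Fin 2) ℂ)
                * ℓ l (((F.P K).L : ℤ) • (fun μ => ((z μ).val : ℤ)) + boxVec (F.P K).L r)
                * (((hol (avgIter (F.P K).L U₀' l) (((F.P K).L : ℤ) • (fun μ => ((z μ).val : ℤ))) (treeWord (boxVec (F.P K).L r)))⁻¹ : (Matrix (Fin 2) (Fin 2) ℂ)ˣ) : Matrix (Fin 2) (Fin 2) ℂ))‖ :=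
    Finset.sum_congr rfl fun z _ => by rw [hlin z]
  rw [hLHS]
  refine hstep.trans ?_
  -- the `ℓ¹` letters of the right side
  have hSRsum : ∑ z : Site (F.P K) (l + 1), (((F.P K).L : ℝ) ^ (F.P K).d)⁻¹ * ∑ _r : Fin (F.P K).d → Fin (F.P K).L, (3 * (F.L : ℝ) * Dbox z + 9 * (F.L : ℝ) ^ 2 * Bl z)
      = 3 * (F.L : ℝ) * ∑ z : Site (F.P K) (l + 1), Dbox z + 9 * (F.L : ℝ) ^ 2 * ∑ z : Site (F.P K) (l + 1), Bl z := by
    have hL3ne : ((F.L : ℝ) ^ 3) ≠ 0 := by positivity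
    rw [Finset.mul_sum, Finset.mul_sum, ← Finset.sum_add_distrib]
    refine Finset.sum_congr rfl fun z _ => ?_
    rw [Finset.sum_const, Finset.card_univ, nsmul_eq_mul, hcardR, hLd]
    field_simp
  have hDsum : ∑ z : Site (F.P K) (l + 1), Dbox z = ∑ x : Site (F.P K) l, ∑ κ : Fin (F.P K).d, D l l x κ := by
    rw [hDbox]; dsimp only
    rw [Finset.sum_congr rfl (fun z _ => sum_blockSite_eq (P := F.P K) hlm z (fun x => ∑ κ : Fin (F.P K).d, D l l x κ)), sum_sum_block_eq]
  have hBsum : ∑ z : Site (F.P K) (l + 1), Bl z = ∑ x : Site (F.P K) l, ∑ κ : Fin (F.P K).d,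
      ‖((tildIter (F.P K).L U₀' (expCfg B') l (fun μ => ((x μ).val : ℤ)) κ : (Matrix (Fin 2) (Fin 2) ℂ)ˣ) : Matrix (Fin 2) (Fin 2) ℂ) - 1‖ ^ 2 := by
    rw [← sum_blockLift_eq (P := F.P K) hlm (fun x' => ∑ κ : Fin (F.P K).d,
      ‖((tildIter (F.P K).L U₀' (expCfg B') l x' κ : (Matrix (Fin 2) (Fin 2) ℂ)ˣ) : Matrix (Fin 2) (Fin 2) ℂ) - 1‖ ^ 2)]
    refine Finset.sum_congr rfl fun z _ => Finset.sum_congr rfl fun r' _ => ?_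
    rw [valLift_blockSite (P := F.P K) hlm z r']
  rw [hSRsum, hDsum, hBsum, hLd]
  have hM0 : 0 ≤ ∑ x : Site (F.P K) l, ∑ κ : Fin (F.P K).d,
      ‖((tildIter (F.P K).L U₀' (expCfg B') l (fun μ => ((x μ).val : ℤ)) κ : (Matrix (Fin 2) (Fin 2) ℂ)ˣ) : Matrix (Fin 2) (Fin 2) ℂ) - 1‖ ^ 2 :=
    Finset.sum_nonneg fun _ _ => Finset.sum_nonneg fun _ _ => sq_nonneg _
  nlinarith [hM0, sq_nonneg (F.L : ℝ)]

end Member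

end Summit.QuantumFields.YangMills.Theorems.Prop7CombFrameRem2RecursionT3

end
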